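import Mathlib
import Literature.Analysis.PDE.TrueKernelElement
import HarnessLib

/-!
# The family of true kernel elements indexed by the exponent `m` (position and velocity types)

Analysis/PDE support file (everything proved). For a potential `P` of inverse-square type
(`TrueKernelElement.lean`) and every `m : ℕ` let `B⁰_m` be the position-type kernel element with
model datum `(x^{m−n}, 0)` when `m` is even and `m ≤ n`, and `0` (with zero model) otherwise; let
`B¹_m` be the velocity-type element with model `(0, x^{m−n})` when `m` is even and `m + 1 ≤ n`,
else `0`. `exists_farKernelFamily` packages, with ONE closeness constant `K = K(n)` uniform in the
potential, the facts needed downstream for all `m`: global `C²`, the equation on `{x ≥ 1}`, the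
`t`-polynomial structure on `{x ≥ 7/8}`, the data closeness `≤ K ε²` to the (indicator-weighted)
model, finite and non-radiating exterior energies. Route PhotonSphereChannels, `FixedModeChannels`,
far side (stmt-FinalStateConjecture-10048). Folklore.
-/

noncomputable section

namespace Literature.Analysis.PDE

open MeasureTheory Set Filter Topology Finset Real

/-- The facts enjoyed by the zero function with the zero model. [folklore] -/
theorem zero_kernel_facts {P : ℝ → ℝ} {K ε : ℝ} (hK : 0 ≤ K) :
    let p : ℝ → ℝ → ℝ := fun _ _ => 0
    ContDiff ℝ 2 (Function.uncurry p) ∧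
    (∀ t z, (1 : ℝ) ≤ z →
      iteratedDeriv 2 (fun τ => p τ z) t - iteratedDeriv 2 (p t) z + P z * p t z = 0) ∧
    (∃ (N : ℕ) (A : ℕ → ℝ → ℝ), ∀ t z, (7 / 8 : ℝ) ≤ z → p t z = ∑ i ∈ range N, A i z * t ^ i) ∧
    IntegrableOn (fun z => (deriv (p 0) z - 0) ^ 2 + P z * (p 0 z - 0) ^ 2
      + (deriv (fun τ => p τ z) 0 - 0) ^ 2) (Ioi 1) ∧
    (∫ z in Ioi 1, ((deriv (p 0) z - 0) ^ 2 + P z * (p 0 z - 0) ^ 2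
      + (deriv (fun τ => p τ z) 0 - 0) ^ 2)) ≤ K * ε ^ 2 ∧
    IntegrableOn (fun z => deriv (fun τ => p τ z) 0 ^ 2 + deriv (p 0) z ^ 2 + P z * p 0 z ^ 2)
      (Ioi 1) ∧
    (∀ t, IntegrableOn (fun z => deriv (fun τ => p τ z) t ^ 2 + deriv (p t) z ^ 2
      + P z * p t z ^ 2) (Ioi (1 + |t|))) ∧
    Tendsto (fun t => ∫ z in Ioi (1 + |t|),
      (deriv (fun τ => p τ z) t ^ 2 + deriv (p t) z ^ 2 + P z * p t z ^ 2)) atTop (𝓝 0) ∧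
    Tendsto (fun t => ∫ z in Ioi (1 + |t|),
      (deriv (fun τ => p τ z) t ^ 2 + deriv (p t) z ^ 2 + P z * p t z ^ 2)) atBot (𝓝 0) := by
  intro p
  have hp : ∀ t z, p t z = 0 := fun _ _ => rfl
  have hd1 : ∀ t z, deriv (fun τ => p τ z) t = 0 := fun t z => by simp [hp]
  have hd2 : ∀ t z, deriv (p t) z = 0 := fun t z => by
    show deriv (fun _ => (0:ℝ)) z = 0; simp
  have he : ∀ t, (fun z => deriv (fun τ => p τ z) t ^ 2 + deriv (p t) z ^ 2 + P z * p t z ^ 2)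
      = fun _ => 0 := fun t => by funext z; simp [hd2, hp]
  refine ⟨contDiff_const, fun t z _ => ?_, ⟨0, fun _ _ => 0, fun t z _ => by simp [hp]⟩, ?_, ?_,
    ?_, ?_, ?_, ?_⟩
  · have h1 : iteratedDeriv 2 (fun τ => p τ z) t = 0 := by
      show iteratedDeriv 2 (fun _ => (0:ℝ)) t = 0; rw [iteratedDeriv_const]; simp
    have h2 : iteratedDeriv 2 (p t) z = 0 := by
      show iteratedDeriv 2 (fun _ => (0:ℝ)) z = 0; rw [iteratedDeriv_const]; simp
    rw [h1, h2, hp t z]; ring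
  · have : (fun z => (deriv (p 0) z - 0) ^ 2 + P z * (p 0 z - 0) ^ 2
        + (deriv (fun τ => p τ z) 0 - 0) ^ 2) = fun _ => 0 := by
      funext z; simp [hd2, hp]
    rw [this]; exact integrableOn_zero
  · have : (fun z => (deriv (p 0) z - 0) ^ 2 + P z * (p 0 z - 0) ^ 2
        + (deriv (fun τ => p τ z) 0 - 0) ^ 2) = fun _ => 0 := by
      funext z; simp [hd2, hp]
    rw [this, integral_zero]; positivity
  · rw [he 0]; exact integrableOn_zero
  · intro t; rw [he t]; exact integrableOn_zero
  · simp_rw [he]; simp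
  · simp_rw [he]; simp

/-- **The kernel family.** See the module docstring. [folklore] -/
theorem exists_farKernelFamily (n : ℕ) :
    ∃ K : ℝ, 0 ≤ K ∧ ∀ {P q : ℝ → ℝ} {ε : ℝ}, Continuous P → (∀ z, 0 ≤ P z) → Continuous q →
      0 ≤ ε → ε ≤ 1 / 64 → (∀ z, 3 / 8 ≤ z → P z = (n : ℝ) * (n + 1) / z ^ 2 + q z) →
      (∀ z, 3 / 8 ≤ z → |q z| ≤ ε * z ^ (-(5 : ℝ) / 2)) →
    ∃ B : ℕ → ℕ → ℝ → ℝ → ℝ, ∀ (ν : ℕ) (m : ℕ), ν ≤ 1 →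
      let p := B ν m
      let χ : ℝ := if Even m ∧ m + ν ≤ n then 1 else 0
      ContDiff ℝ 2 (Function.uncurry p) ∧
      (∀ t z, (1 : ℝ) ≤ z →
        iteratedDeriv 2 (fun τ => p τ z) t - iteratedDeriv 2 (p t) z + P z * p t z = 0) ∧
      (∃ (N : ℕ) (A : ℕ → ℝ → ℝ), ∀ t z, (7 / 8 : ℝ) ≤ z →
        p t z = ∑ i ∈ range N, A i z * t ^ i) ∧
      IntegrableOn (fun z =>
          (deriv (p 0) z - χ * (1 - ν) * ((m : ℝ) - n) * z ^ ((m : ℝ) - n - 1)) ^ 2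
          + P z * (p 0 z - χ * (1 - ν) * z ^ ((m : ℝ) - n)) ^ 2
          + (deriv (fun τ => p τ z) 0 - χ * ν * z ^ ((m : ℝ) - n)) ^ 2) (Ioi 1) ∧
      (∫ z in Ioi 1, ((deriv (p 0) z - χ * (1 - ν) * ((m : ℝ) - n) * z ^ ((m : ℝ) - n - 1)) ^ 2
          + P z * (p 0 z - χ * (1 - ν) * z ^ ((m : ℝ) - n)) ^ 2
          + (deriv (fun τ => p τ z) 0 - χ * ν * z ^ ((m : ℝ) - n)) ^ 2)) ≤ K * ε ^ 2 ∧
      IntegrableOn (fun z => deriv (fun τ => p τ z) 0 ^ 2 + deriv (p 0) z ^ 2 + P z * p 0 z ^ 2)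
          (Ioi 1) ∧
      (∀ t, IntegrableOn (fun z => deriv (fun τ => p τ z) t ^ 2 + deriv (p t) z ^ 2
          + P z * p t z ^ 2) (Ioi (1 + |t|))) ∧
      Tendsto (fun t => ∫ z in Ioi (1 + |t|),
        (deriv (fun τ => p τ z) t ^ 2 + deriv (p t) z ^ 2 + P z * p t z ^ 2)) atTop (𝓝 0) ∧
      Tendsto (fun t => ∫ z in Ioi (1 + |t|),
        (deriv (fun τ => p τ z) t ^ 2 + deriv (p t) z ^ 2 + P z * p t z ^ 2)) atBot (𝓝 0) := by
  -- uniform constants, one for each `(ν, m)`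
  have hel : ∀ ν m : ℕ, ∃ K : ℝ, 0 ≤ K ∧ (ν ≤ 1 → Even m → m + ν ≤ n →
      ∀ {P q : ℝ → ℝ} {ε : ℝ}, Continuous P → (∀ z, 0 ≤ P z) → Continuous q →
      0 ≤ ε → ε ≤ 1 / 64 → (∀ z, 3 / 8 ≤ z → P z = (n : ℝ) * (n + 1) / z ^ 2 + q z) →
      (∀ z, 3 / 8 ≤ z → |q z| ≤ ε * z ^ (-(5 : ℝ) / 2)) →
      ∃ p : ℝ → ℝ → ℝ, ContDiff ℝ 2 (Function.uncurry p) ∧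
      (∀ t z, (1 : ℝ) ≤ z →
        iteratedDeriv 2 (fun τ => p τ z) t - iteratedDeriv 2 (p t) z + P z * p t z = 0) ∧
      (∃ (N : ℕ) (A : ℕ → ℝ → ℝ), ∀ t z, (7 / 8 : ℝ) ≤ z →
        p t z = ∑ k ∈ range N, A k z * t ^ k) ∧
      IntegrableOn (fun z =>
          (deriv (p 0) z - (1 - ν) * ((2 * (m / 2 : ℕ) : ℝ) - n)
            * z ^ ((2 * (m / 2 : ℕ) : ℝ) - n - 1)) ^ 2
          + P z * (p 0 z - (1 - ν) * z ^ ((2 * (m / 2 : ℕ) : ℝ) - n)) ^ 2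
          + (deriv (fun τ => p τ z) 0 - ν * z ^ ((2 * (m / 2 : ℕ) : ℝ) - n)) ^ 2) (Ioi 1) ∧
      (∫ z in Ioi 1, ((deriv (p 0) z - (1 - ν) * ((2 * (m / 2 : ℕ) : ℝ) - n)
            * z ^ ((2 * (m / 2 : ℕ) : ℝ) - n - 1)) ^ 2
          + P z * (p 0 z - (1 - ν) * z ^ ((2 * (m / 2 : ℕ) : ℝ) - n)) ^ 2
          + (deriv (fun τ => p τ z) 0 - ν * z ^ ((2 * (m / 2 : ℕ) : ℝ) - n)) ^ 2)) ≤ K * ε ^ 2 ∧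
      IntegrableOn (fun z => deriv (fun τ => p τ z) 0 ^ 2 + deriv (p 0) z ^ 2 + P z * p 0 z ^ 2)
          (Ioi 1) ∧
      (∀ t, IntegrableOn (fun z => deriv (fun τ => p τ z) t ^ 2 + deriv (p t) z ^ 2
          + P z * p t z ^ 2) (Ioi (1 + |t|))) ∧
      Tendsto (fun t => ∫ z in Ioi (1 + |t|),
        (deriv (fun τ => p τ z) t ^ 2 + deriv (p t) z ^ 2 + P z * p t z ^ 2)) atTop (𝓝 0) ∧
      Tendsto (fun t => ∫ z in Ioi (1 + |t|),
        (deriv (fun τ => p τ z) t ^ 2 + deriv (p t) z ^ 2 + P z * p t z ^ 2)) atBot (𝓝 0)) := by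
    intro ν m
    by_cases h : ν ≤ 1 ∧ Even m ∧ m + ν ≤ n
    · have hj : 2 * (m / 2) + ν ≤ n := by rw [Nat.two_mul_div_two_of_even h.2.1]; exact h.2.2
      obtain ⟨K, hK0, hK⟩ := exists_trueKernelElement n h.1 (j := m / 2) hj
      exact ⟨K, hK0, fun _ _ _ P q ε h1 h2 h3 h4 h5 h6 h7 => hK h1 h2 h3 h4 h5 h6 h7⟩
    · exact ⟨0, le_rfl, fun h1 h2 h3 => absurd ⟨h1, h2, h3⟩ h⟩
  choose Kf hKf0 hKf using hel
  set K : ℝ := ∑ ν ∈ range 2, ∑ m ∈ range (n + 1), Kf ν m with hKdef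
  have hK0 : 0 ≤ K := Finset.sum_nonneg fun ν _ => Finset.sum_nonneg fun m _ => hKf0 ν m
  have hKle : ∀ ν m, ν ≤ 1 → m ≤ n → Kf ν m ≤ K := by
    intro ν m hν hm
    calc Kf ν m ≤ ∑ m' ∈ range (n + 1), Kf ν m' :=
          Finset.single_le_sum (f := fun m' => Kf ν m') (fun m' _ => hKf0 ν m')
            (mem_range.2 (Nat.lt_succ_of_le hm))
      _ ≤ K := Finset.single_le_sum (f := fun ν' => ∑ m' ∈ range (n + 1), Kf ν' m')
            (fun ν' _ => Finset.sum_nonneg fun m' _ => hKf0 ν' m') (mem_range.2 (by omega))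
  refine ⟨K, hK0, ?_⟩
  intro P q ε hPc hP0 hq hε hε1 hPq hqb
  -- the elements
  have hex : ∀ ν m : ℕ, ∃ p : ℝ → ℝ → ℝ, ν ≤ 1 →
      let χ : ℝ := if Even m ∧ m + ν ≤ n then 1 else 0
      ContDiff ℝ 2 (Function.uncurry p) ∧
      (∀ t z, (1 : ℝ) ≤ z →
        iteratedDeriv 2 (fun τ => p τ z) t - iteratedDeriv 2 (p t) z + P z * p t z = 0) ∧
      (∃ (N : ℕ) (A : ℕ → ℝ → ℝ), ∀ t z, (7 / 8 : ℝ) ≤ z →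
        p t z = ∑ i ∈ range N, A i z * t ^ i) ∧
      IntegrableOn (fun z =>
          (deriv (p 0) z - χ * (1 - ν) * ((m : ℝ) - n) * z ^ ((m : ℝ) - n - 1)) ^ 2
          + P z * (p 0 z - χ * (1 - ν) * z ^ ((m : ℝ) - n)) ^ 2
          + (deriv (fun τ => p τ z) 0 - χ * ν * z ^ ((m : ℝ) - n)) ^ 2) (Ioi 1) ∧
      (∫ z in Ioi 1, ((deriv (p 0) z - χ * (1 - ν) * ((m : ℝ) - n) * z ^ ((m : ℝ) - n - 1)) ^ 2
          + P z * (p 0 z - χ * (1 - ν) * z ^ ((m : ℝ) - n)) ^ 2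
          + (deriv (fun τ => p τ z) 0 - χ * ν * z ^ ((m : ℝ) - n)) ^ 2)) ≤ K * ε ^ 2 ∧
      IntegrableOn (fun z => deriv (fun τ => p τ z) 0 ^ 2 + deriv (p 0) z ^ 2 + P z * p 0 z ^ 2)
          (Ioi 1) ∧
      (∀ t, IntegrableOn (fun z => deriv (fun τ => p τ z) t ^ 2 + deriv (p t) z ^ 2
          + P z * p t z ^ 2) (Ioi (1 + |t|))) ∧
      Tendsto (fun t => ∫ z in Ioi (1 + |t|),
        (deriv (fun τ => p τ z) t ^ 2 + deriv (p t) z ^ 2 + P z * p t z ^ 2)) atTop (𝓝 0) ∧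
      Tendsto (fun t => ∫ z in Ioi (1 + |t|),
        (deriv (fun τ => p τ z) t ^ 2 + deriv (p t) z ^ 2 + P z * p t z ^ 2)) atBot (𝓝 0) := by
    intro ν m
    by_cases hc : Even m ∧ m + ν ≤ n
    · by_cases hν : ν ≤ 1
      · obtain ⟨p, hC, heq, hst, hclI, hcl, hE0, hEt, htop, hbot⟩ :=
          hKf ν m hν hc.1 hc.2 hPc hP0 hq hε hε1 hPq hqb
        have e2 : (2 : ℝ) * ((m / 2 : ℕ) : ℝ) = (m : ℝ) := by
          exact_mod_cast Nat.two_mul_div_two_of_even hc.1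
        simp only [e2] at hclI hcl
        refine ⟨p, fun _ => ?_⟩
        intro χ
        have hχ : χ = 1 := if_pos hc
        simp only [hχ, one_mul]
        refine ⟨hC, heq, hst, hclI, hcl.trans ?_, hE0, hEt, htop, hbot⟩
        exact mul_le_mul_of_nonneg_right (hKle ν m hν (by omega)) (sq_nonneg _)
      · exact ⟨fun _ _ => 0, fun h => absurd h hν⟩
    · refine ⟨fun _ _ => 0, fun _ => ?_⟩
      intro χ
      have hχ : χ = 0 := if_neg hc
      simp only [hχ, zero_mul]
      exact zero_kernel_facts (P := P) (ε := ε) hK0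
  choose B hB using hex
  exact ⟨B, fun ν m hν => hB ν m hν⟩

end Literature.Analysis.PDE
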